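import Literature.RingTheory.TightClosure.TightClosure
import Mathlib.RingTheory.LocalRing.MaximalIdeal.Basic
import HarnessLib

/-!
# The socle lemma for isolated rung-3 defects (crux `FrobeniusLadder.FRationalModification`)

Support lemma for crux stmt-ResolutionOfSingularities-15316 (route `FrobeniusLadder`, rung 3), the
first lemma of the crux idea cards `cartier-crystal-centres` and `socle-discrepancy-certificate`
(`Cruxes/FRationalModification/Ideas/`, (F3) "socle rigidity"), filed in tree by the line lead so that
a line built on those cards starts from a checked lemma:

**Socle lemma.** Let `(R, 𝔪)` be a local ring of prime characteristic `p` in which every ideal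
generated by a system of parameters is Frobenius closed (the rung-2 / F-injective half of the crux's
antecedent), and suppose the tight-closure defect of parameter ideals is killed by a FIXED power of
`𝔪`: `𝔪ᴺ · (s)^* ⊆ (s)` for every system of parameters `s` (the tree-typable form of "the parameter
test ideal is `𝔪`-primary", i.e. the non-F-rational locus is the closed point). Then already
`𝔪 · (s)^* ⊆ (s)` for every system of parameters `s`: the whole defect `(s)^*/(s)` sits in the socle
of `R/(s)`.

Proof (`socleLemma`). Take `q = pᴺ ≥ N`. The `q`-th powers `s^q` form again a system of parameters,
generating `(s)^[q]`, and `y ∈ (s)^*` gives `y^q ∈ ((s)^[q])^*` (`pow_mem_tightClosure_frobeniusPower`);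
for `r ∈ 𝔪` one has `r^q ∈ 𝔪^q ⊆ 𝔪ᴺ`, so `(ry)^q = r^q y^q ∈ 𝔪ᴺ ((s)^[q])^* ⊆ (s)^[q]`, i.e.
`ry` lies in the Frobenius closure of `(s)`, which is `(s)`. No Cohen–Macaulay, excellence or
F-finiteness hypothesis and no restriction on the residue field is needed.
-/

-- single-problem summit: the doubled namespace component `ResolutionOfSingularities` is forced
set_option linter.dupNamespace false

open IsLocalRing Literature.RingTheory.TightClosure

namespace Summit.ResolutionOfSingularities.ResolutionOfSingularities.Theorems.FRationalModification.SocleLemma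

section Helpers

variable {R : Type*} [CommRing R] (p : ℕ) [ExpChar R p]

/-- **Tight closure commutes with Frobenius powers, one direction**: `y ∈ I^*` implies
`y^q ∈ (I^[q])^*` for `q = p^e` (the same witness `c`: `c (y^q)^{q'} = c y^{qq'} ∈ I^[qq'] = (I^[q])^[q']`).
[cite: HochsterHuneke1990, Prop. 4.1 (l) (proof idea); folklore] -/
theorem pow_mem_tightClosure_frobeniusPower {I : Ideal R} {y : R} (hy : y ∈ tightClosure p I)
    (e : ℕ) : y ^ p ^ e ∈ tightClosure p (frobeniusPower (p ^ e) I) := by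
  obtain ⟨c, hc, e₀, h⟩ := (mem_tightClosure_iff p).mp hy
  refine (mem_tightClosure_iff p).mpr ⟨c, hc, e₀, fun e' he' => ?_⟩
  rw [frobeniusPower_frobeniusPower p e e', ← pow_mul, ← pow_add]
  exact h (e + e') (le_add_left he')

/-- The `q`-th powers of a tuple generate the `q`-th Frobenius power of the ideal the tuple
generates (`q = p^e`). [folklore] -/
theorem span_range_pow_eq_frobeniusPower {d : ℕ} (s : Fin d → R) (e : ℕ) :
    Ideal.span (Set.range fun i => s i ^ p ^ e) =
      frobeniusPower (p ^ e) (Ideal.span (Set.range s)) := by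
  rw [frobeniusPower_span p e (Set.range s), ← Set.range_comp]
  rfl

/-- Raising a system of parameters to the `q`-th power (`q = p^e`) gives a system of parameters
(same number of elements, same radical). [folklore] -/
theorem isSystemOfParameters_pow [IsLocalRing R] {d : ℕ} {s : Fin d → R}
    (hs : IsSystemOfParameters s) (e : ℕ) :
    IsSystemOfParameters fun i => s i ^ p ^ e := by
  refine ⟨hs.1, ?_⟩
  rw [span_range_pow_eq_frobeniusPower p s e, frobeniusPower_def, ← hs.2]
  refine le_antisymm (Ideal.radical_mono (Ideal.span_le.mpr ?_))
    (Ideal.radical_le_radical_iff.mpr fun x hx => Ideal.mem_radical_iff.mpr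
      ⟨p ^ e, Ideal.subset_span ⟨x, hx, rfl⟩⟩)
  rintro _ ⟨x, hx, rfl⟩
  exact Ideal.pow_mem_of_mem _ hx _ (expChar_pow_pos R p e)

end Helpers

/-- **Socle lemma** (cards `cartier-crystal-centres` (F3), `socle-discrepancy-certificate`). In a
local ring `(R, 𝔪)` of prime characteristic `p` whose parameter ideals are all Frobenius closed, if
a fixed power `𝔪ᴺ` multiplies the tight closure of every parameter ideal back into the ideal, then
so does `𝔪` itself: `𝔪 · (s)^* ⊆ (s)` for every system of parameters `s` — the tight-closure defect
of an isolated non-F-rational rung-2 point lives in the socle. [folklore] -/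
theorem socleLemma (p : ℕ) [Fact p.Prime] {R : Type*} [CommRing R] [IsLocalRing R] [CharP R p]
    (hF : ∀ ⦃d : ℕ⦄ (s : Fin d → R), IsSystemOfParameters s →
      IsFrobeniusClosed p (Ideal.span (Set.range s)))
    (hN : ∃ N : ℕ, ∀ ⦃d : ℕ⦄ (s : Fin d → R), IsSystemOfParameters s →
      maximalIdeal R ^ N * tightClosure p (Ideal.span (Set.range s)) ≤ Ideal.span (Set.range s))
    ⦃d : ℕ⦄ (s : Fin d → R) (hs : IsSystemOfParameters s) :
    maximalIdeal R * tightClosure p (Ideal.span (Set.range s)) ≤ Ideal.span (Set.range s) := by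
  have hp : p.Prime := Fact.out
  obtain ⟨N, hN⟩ := hN
  refine Ideal.mul_le.mpr fun r hr y hy => ?_
  -- `q = p^N ≥ N`; the `q`-th powers of `s` form a system of parameters generating `(s)^[q]`
  have hNq : N ≤ p ^ N := (Nat.lt_pow_self hp.one_lt).le
  have hs' := isSystemOfParameters_pow p hs N
  have hkill := hN _ hs'
  rw [span_range_pow_eq_frobeniusPower p s N] at hkill
  -- `r^q ∈ 𝔪^N` and `y^q ∈ ((s)^[q])^*`, so `(r y)^q ∈ (s)^[q]`
  have hrq : r ^ p ^ N ∈ maximalIdeal R ^ N :=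
    Ideal.pow_le_pow_right hNq (Ideal.pow_mem_pow hr _)
  have hyq := pow_mem_tightClosure_frobeniusPower p hy N
  have hry : (r * y) ^ p ^ N ∈ frobeniusPower (p ^ N) (Ideal.span (Set.range s)) := by
    rw [mul_pow]
    exact hkill (Ideal.mul_mem_mul hrq hyq)
  -- Frobenius closedness of `(s)`
  have hmem : r * y ∈ frobeniusClosure p (Ideal.span (Set.range s)) :=
    (mem_frobeniusClosure_iff p).mpr ⟨N, hry⟩
  have hcl : frobeniusClosure p (Ideal.span (Set.range s)) = Ideal.span (Set.range s) := hF s hs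
  rwa [hcl] at hmem

end Summit.ResolutionOfSingularities.ResolutionOfSingularities.Theorems.FRationalModification.SocleLemma
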